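import Mathlib
import HarnessLib
import HarnessLib.Audit
import Summits.FinalStateConjecture.Statement
import Literature.Geometry.Lorentzian.CoordTensorRicciIdentity
import HarnessLib.Audit.Status.Attr

/-!
Route: SuperenergyCensus

DORMANT since 2026-08-24T02:26:56Z (reconciler: no traction for 6.4 d (last activity item-evidence-added at 2026-08-17T14:57:37Z); parked, not closed — `ledger route dormant route-FinalStateConjecture-SuperenergyCensus --off` to reactiv) — unstaffed, not closed; items shared with open routes are served there. `ledger route dormant <id> --off` reactivates.

# Route SuperenergyCensus — finitely many Kerr because small holes are expensive — late-time
superenergy census with an inverted (1/M) quantum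

It suffices to show X = G ∧ C (card superenergy-census-inverted-quantum, the spine; G realises its
K2/K3 "census slices + SE∞" in the
summit's own chart language, C its CENSUS corollary, and its K1 = T1 is the layer-2 tool filed as
the rank-4 crux EpsilonRegularityNoStrongTrapping).
G (GenericCountableKerrSettling): TAME-Christodoulou-generic admissible data (re-type T2, p126844:
`IsTameChristodoulouGeneric`, witness families tame on ONE fixed end and immersed at 0) have an
MGHD, and every MGHD has complete 𝓘⁺ and settles in C² to a family of
SUB-EXTREMAL boosted Kerr near zones indexed by an ARBITRARY type ι — finiteness is NOT assumed —
plus a flat radiation zone, with the summit's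
separation / covering / O = J⁺(ιX) ∩ I⁻(charts) / rays-stay-in-closure-O / honest-radii
exhaustive-charts / future-orientation clauses verbatim (ι in place of Fin N), hole masses Mᵢ ≤ M
(the ADM mass parameter of the datum), and ONE
late-time analytic bound: the Bel–Robinson superenergy ∫ Q(n,n,n,n) = (1/8)∫|Rm|²_ĝ of the certified
Kerr–Schild collars {t*ᵢ = τ, r₊ < rᵢ ≤ 4Mᵢ} (computed
in the hole charts from Ψᵢ*g, ĝ = g + 2N² dt*⊗dt*), summed over any finite set of holes, is
frequently-in-τ ≤ C < ∞.
C (InvertedQuantumCensus): for ANY spacetime and any such ι-family, C² near-zone convergence + Mᵢ ≤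
K + that bound ⟹ ι is finite — because a settled
hole of mass M carries collar superenergy → J(Λ)·𝓔_Kerr(M,a) ≥ c/M (∫|Rm|² has dimension 1/length in
3+1: SMALL HOLES ARE EXPENSIVE; the Euclidean
3-Jacobian of a Lorentz map on a spacelike slab is J = √(1+2|a⃗|²) ≥ 1), so Σᵢ c/Mᵢ ≤ C while Mᵢ ≤
K: |ι| ≤ CK/c (AM–GM form of the inverted quantum).
A finite ι re-indexes (ι ≃ Fin N, pure bookkeeping proved INSIDE `closes`) to a
`FinalStateDecomposition … O 2` over the SAME O with the summit's decomposition clauses —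
sub-extremality, O = exteriorOf d.charted, HasExhaustiveCharts d, IsFutureOriented d —,
RaysStayInClosure O is carried over from G unchanged, and tame genericity is monotone in the
property, so G ∧ C ⟹ FSC.
Lean: `GenericCountableKerrSettling ∧ InvertedQuantumCensus`

## Assembly
`closes : GenericCountableKerrSettling → InvertedQuantumCensus → FinalStateConjecture`, sorry-free
(Sketch2.lean / glue.lean, rc 0, axioms standard; re-elaborated 2026-08-16 after the Statement
re-type T2, p126844; its only non-crux hypothesis is the support InvertedQuantumCensus = THE CENSUS,
to be PROVED as an item and then invoked as `InvertedQuantumCensus_holds`): tame Christodoulou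
genericity `IsTameChristodoulouGeneric 𝓓 P 1 = HasTameCodimAtLeastIn 𝓓 {d ∈ 𝓓 | ¬P d} 1`
is MONOTONE in P (the exceptional set of a weaker property is smaller, and the same tame, immersed,
injective one-parameter family on the same end works), so it suffices that for every admissible
D the census package of GenericCountableKerrSettling implies the summit's per-datum property; given
the package, for each MGHD: complete 𝓘⁺ is carried over,
InvertedQuantumCensus (with K = M) gives Finite ι, the re-indexing along ι ≃ Fin N
(Finite.exists_equiv_fin; every field precomposed with the equivalence, ι- and Fin N-unions
identified by Surjective.iUnion_comp — formerly the support item FiniteFamilyAssembly, now proved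
inside `closes`) produces d over the same O with sub-extremality, O = exteriorOf d.charted,
HasExhaustiveCharts d (honest radii Rⱼ := R_{e⁻¹ j}) and IsFutureOriented d, and RaysStayInClosure O
is G's own clause.
KerrCollarSuperenergyFloor is NOT a hypothesis of `closes` (it is the calibration the census prover
consumes, kept as a support item). Genericity is NOT closed under ∧,
which is why exactly one item (G) carries `IsTameChristodoulouGeneric` and all others are
deterministic.

Rationale: WHY THIS LINE. Mass can be split without bound (Σ Mᵢ ≤ M_ADM never bounds N), but superenergy
cannot: in 3+1 dimensions ∫_Σ |Rm|² has length dimension −1, so the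
Kerr near zone of a hole of mass M costs ≍ 1/M (Schwarzschild, t = const: 16π/(5M)), and one
late-time L² curvature integral CAPS the number of remnants and
FLOORS the lightest one — the bubble-tree finiteness scheme of gauge theory / harmonic maps
(Uhlenbeck1982, Sacks–Uhlenbeck: energy quantum per bubble ⟹
finitely many bubbles) transplanted with an INVERTED quantum (dictionary: energy ↦ Bel–Robinson
superenergy Senovilla2000, ChristodoulouKlainerman1993;
bubble ↦ Kerr near zone; ε-regularity ↦ KRS local L² theorem KlainermanRodnianskiSzeftel2015 +
Penrose1965PRL focusing; neck ↦ radiation zone with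
|Rm|² ~ r⁻⁶). The typed layer isolates exactly the step every final-state argument must contain and
nobody has isolated — "why finitely many?" — as a
deterministic theorem (C) about C²-settled families, stated with the prelude's coordinate curvature
calculus (MetricCoord.rm4 / tnormSq) so that it
elaborates today, and concentrates all open analysis (weak cosmic censorship DafermosLuk2017 /
Christodoulou1999, large-data Kerr asymptotic stability
KlainermanSzeftel2023, GiorgiKlainermanSzeftel2022, DafermosHolzegelRodnianskiTaylor2021, Bondi mass
bookkeeping BondiVanderburgMetzner1962) in ONE
generic crux G whose only non-standard clause is an L² NON-CONCENTRATION statement for curvature at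
late times, falsifiable on its own (refuters: a
generic mechanism producing infinitely many ever-smaller holes must make the collar superenergy
diverge). The negatives index is empty; no prior route exists on this summit.

RANKED CRUXES. #2 GenericCountableKerrSettling (crux) — For every connected Hausdorff
second-countable smooth 3-manifold X, TAME-Christodoulou-generically in admissibleVacuumData X
(IsTameChristodoulouGeneric … 1: one fixed end, tame + immersed witness families; re-type T2): an
MGHD exists, and every MGHD 𝒟 has complete future null infinity
(Summit.FinalStateConjecture.HasCompleteNullInfinity) and, for some AF end e with DR mass parameter
M, a region O ⊆ 𝒟, an index type ι, masses/spins with |aᵢ| < Mᵢ (Kerr.IsSubextremal), motions (Λᵢ,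
cᵢ), a late time τ₀, hole charts Ψᵢ on the boosted Kerr exteriors and a flat chart Ψ₀ on flatDomain
⊇ {x⁰ > τ₀} minus sublinear tubes, such that: every Ψᵢ, Ψ₀ is a late chart into O; C² deviation from
boosted Kerr → 0 on every truncated slab {t*ᵢ = τ, rᵢ ≤ R}; near zones eventually pairwise disjoint
for every R; C² deviation from η → 0 on the flat slabs; the covering clause O ∖ (late images) ⊆
J⁻(initial slabs); O = exteriorOf 𝒟 (charted region); every future-complete normalised null ray from
the data stays in closure O (RaysStayInClosure 𝒟 O); the exhaustive-charts clause with HONEST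
growing radii Rᵢ(τ) → ∞, Rᵢ(τ) ≥ max(r₊(Mᵢ, aᵢ), 0) + 1; chart times future-oriented (every Λᵢ
orthochronous; eventually in τ the push-forward of Λᵢ V_{Mᵢ,aᵢ}(Λᵢ⁻¹(x − cᵢ)), V = Kerr.timeVector,
on every truncated slab {t*ᵢ = τ, rᵢ ≤ ρ} and of ∂₀ on the flat slabs is future-directed) (all
verbatim the fields of FinalStateDecomposition / HasExhaustiveCharts / IsFutureOriented with Fin N
replaced by ι; in the Lean term `B i` abbreviates the boosted Kerr background of hole i, `G i` the
components of Ψᵢ*g = deviation + background, `M₀` the Minkowski background on flatDomain —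
`let`-bound, definitionally transparent); Mᵢ ≤ M for all i; and ∃ C < ∞ such that for every finite s
⊆ ι, frequently as τ → ∞, Σ_{i∈s} 𝓔ᵢ(τ) ≤ C, where 𝓔ᵢ(τ) = (1/8) ∫ over {y ∈ domᵢ, t*ᵢ(y) = τ, rᵢ(y)
≤ 4Mᵢ} of |Rm_G|²_ĝ dμ_H³, G = Ψᵢ*g in Kerr–Schild coordinates, ĝ = G + 2N² dt*ᵢ⊗dt*ᵢ, N² =
−1/G⁻¹(dt*ᵢ,dt*ᵢ) (the Bel–Robinson superenergy Q(n,n,n,n) of the certified collar). Card items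
K2+K3 in chart form; finiteness deliberately absent. [difficulty: open-problem] (why it might fail:
Contains weak cosmic censorship + large-data multi-Kerr asymptotic stability; refuted by a GENERIC
mechanism forming infinitely many ever-smaller holes (iterated near-threshold focusing,
Choptuik/Abrahams–Evans scaling), or by a settled hole with Mᵢ > M_ADM.) [DafermosLuk2017,
Christodoulou1999, KlainermanSzeftel2023, GiorgiKlainermanSzeftel2022,
DafermosHolzegelRodnianskiTaylor2021, BondiVanderburgMetzner1962, Choptuik1993, AbrahamsEvans1993,
GundlachMartingarcia2007]
#3 InvertedQuantumCensus (crux) — THE CENSUS. For every Spacetime 𝓢 (dim 4), region O, index type ι,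
sub-extremal parameters (Mᵢ, aᵢ), motions, τ₀ and hole charts Ψᵢ that are late charts into O whose
C² deviation from boosted Kerr (Mᵢ, aᵢ, Λᵢ, cᵢ) tends to 0 on every truncated slab: if the masses
are bounded (Mᵢ ≤ K) and the collar superenergies satisfy ∃ C < ∞, ∀ finite s ⊆ ι, frequently in τ,
Σ_{i∈s} 𝓔ᵢ(τ) ≤ C (same 𝓔ᵢ, `B i`, `G i` as in GenericCountableKerrSettling), then ι is finite.
Intended proof: C² convergence on the collar {r₊ < r ≤ 4Mᵢ} makes 𝓔ᵢ(τ) → J(Λᵢ)·𝓔_Kerr(Mᵢ, aᵢ) with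
Euclidean 3-Jacobian J(Λ) = √(1 + 2|a⃗|²) ≥ 1 of the Lorentz map on the slab and 𝓔_Kerr(M, a) ≥ c/M
(KerrCollarSuperenergyFloor, scaling x ↦ Mx); hence |s|·c/K ≤ Σ_{i∈s} c/Mᵢ ≤ C for every finite s.
Duplicated charts are charged per index, so no disjointness is needed. Card: CENSUS corollary (N ≤
(𝓔/ε₀c)·max Rᵢ) in the settled regime. [deps: KerrCollarSuperenergyFloor] [difficulty: M] (why it
might fail: Needs inf over |a|≤M of the Kerr–Schild collar superenergy > 0 (extremal end included)
and convergence of coordinate-curvature integrals from C² sup-norm convergence on collars open at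
r→r₊⁺ (uniform nondegeneracy of Ψ*g); a degenerate direction of the typed density would break the
floor.) [KlainermanRodnianskiSzeftel2015, Senovilla2000, ChristodoulouKlainerman1993,
KerrSchild1965, Uhlenbeck1982]
#— FiniteFamilyAssembly (former support item, DROPPED 2026-08-16): the re-indexing glue ι ≃ Fin N
(every field precomposed with the equivalence; radii Rⱼ := R_{e⁻¹ j}; 0 < Mᵢ, |aᵢ| ≤ Mᵢ from |aᵢ| <
Mᵢ; ι- and Fin N-indexed unions identified by Function.Surjective.iUnion_comp, pairwise disjointness
by Pairwise.comp_of_injective) is now PROVED inside `closes` (crux-only policy: glue is proved, not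
assumed).
#9 KerrCollarSuperenergyFloor (support) — Calibration P1 of the card (provable now, explicit): there
is c > 0 such that for all 0 < M and |a| ≤ M the coordinate Bel–Robinson superenergy of the
Kerr–Schild slice {t* = 0, r₊ < r ≤ 4M} of Kerr (M, a) — (1/8)∫ |Rm_g|²_ĝ dμ_H³ with g = Kerr.bilin
M a, ĝ = g + 2N² dt*⊗dt* — is at least c/M. Proof: scaling x ↦ Mx gives 𝓔(M, a) = 𝓔(1, a/M)/M; χ ↦
𝓔(1, χ) is continuous on [−1, 1] (r₊ = 1 + √(1−χ²) continuous, integrand smooth and bounded on r ≥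
1) and positive (Kerr is nowhere flat on the collar; the collar r₊ ≤ 2 < 4 has positive measure);
Numerically (kit j001624): M·𝓔 = 2.749 (= 7π/8 exactly at a = 0), 3.05, 4.32, 6.99, 10.66, 14.99,
25.04, 40.07 at a/M = 0, .3, .6, .8, .9, .95, .99, 1 — monotone increasing, so c = 7π/8 works on the
sampled set. [difficulty: M] [KerrSchild1965, Senovilla2000, ChristodoulouKlainerman1993]

TWO-LAYER PLAN. Foreseen glued split of G once the census C closes (k = 3, depth 1): G ⇐ G₁ → G₂ →
G₃ → G with
G₁ (WCC + census slices, generic): complete 𝓘⁺ and, for all large τ, asymptotically flat census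
slices Σ′_τ anchored at late retarded time, crossing
every component of the event horizon and truncated at bounded trapped depth, with liminf_τ of their
GEOMETRIC Bel–Robinson superenergy finite (card K2+K3;
needs the definition requests below); G₂ = EpsilonRegularityNoStrongTrapping (card K1 = T1, filed
now as the rank-4 informal crux): on a ball B_r of a
maximal vacuum slice with volume radius ≥ v₀ and r(‖Ric‖²_L²(B_r) + ‖∇k‖²_L²(B_r)) ≤ ε₀(v₀) no
closed surface in B_(r/2) has both null expansions ≤ −C₀/r
(KRS local theorem + Raychaudhuri + Penrose's compactness contradiction) — so bounded superenergy ⟹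
finitely many, floored, separated horizon components;
G₃ (per-component large-data asymptotic Kerr stability + Bondi bookkeeping): each such component
settles in C² (Kerr–Schild gauge down to r₊) to a
sub-extremal boosted Kerr, masses ≤ final Bondi mass ≤ M_ADM, charts exhaust J⁻(𝓘⁺) — giving the
ι-family of G with the collar bound.
C itself may split as C ⇐ (coordinate-curvature continuity under C² deviation) → (Lorentz-Jacobian +
Kerr calibration) → C if a prover asks.

KILL CRITERIA. (Re-type T2: a refutation of G that only exploits the rays / orientation /
honest-radii clauses refutes the Statement's own conclusion shape and goes to the statement audit,
not to a pivot of this line.) Refutation of InvertedQuantumCensus (an infinite C²-settled family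
with bounded collar superenergy and bounded masses, e.g. via a degenerate direction of
the typed density) closes the route `refuted:InvertedQuantumCensus` unless the witness only exploits
the coordinate rendering (then restate with the
geometric superenergy once defined). Refutation of GenericCountableKerrSettling by a generic
infinite-remnant mechanism refutes FSC itself (hand the witness
to the negative side); refutation only of its clause Mᵢ ≤ M or of the collar bound forces a pivot:
replace Mᵢ ≤ M by sup Mᵢ < ∞ (all C needs) or move the
bound to geometric census slices (G₁). KerrCollarSuperenergyFloor false (c = 0 at some |a| ≤ M)
kills the inverted quantum outright. FSC proved along
any other route moots this one; a proof of G₃-type statements elsewhere is imported, not duplicated.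

NOT DECOMPOSED YET. Deliberately NOT items at open: the geometric (chart-free) superenergy of a
hypersurface and census slices (definition requests; G₁); T1's typed form
(needs volume radius and |∇k|²; filed informally); the per-component stability statement G₃ and the
Bondi-mass inequality Σ Mᵢ ≤ M_Bondi ≤ M_ADM; the
constants ε₀(v₀), C₀, c = inf_χ 𝓔_Kerr(1, χ); the change-of-variables / Jacobian lemma J(Λ) =
√(1+2|a⃗|²) and the continuity of MetricCoord.rm4 under
C² convergence (prover helpers via --supports InvertedQuantumCensus); Brill–Lindquist / Misner
multi-hole calibration (card P2) and the short-pulse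
cost 𝓔 ≳ δ⁻²/m (card P3).

CHEAPEST FALSIFIER. RUN by this seat (kit job j001624, evidence attached to
KerrCollarSuperenergyFloor; script kerr_collar_se.py: Kerr–Schild components, nested central
differences for Γ and ∂Γ, full contractions, Gauss–Legendre 40×24 in ellipsoidal coordinates;
validated at a = 0: Kretschmann rel. error 2·10⁻⁶, density
= K/8 exactly (B = 0), integral 2.748895 vs exact 7π/8 = 2.748894): c(χ) := M·𝓔_Kerr(M, χM) on the
Kerr–Schild slice t* = 0 over r₊ < r ≤ 4M is
2.749, 3.046, 4.324, 6.986, 10.658, 14.985, 25.041, 40.074 at χ = 0, 0.3, 0.6, 0.8, 0.9, 0.95, 0.99,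
1 — MONOTONE INCREASING, minimum at Schwarzschild.
So the floor of KerrCollarSuperenergyFloor holds numerically with c = 7π/8 ≈ 2.7489 UNIFORMLY on |a|
≤ M (near-extremal remnants are MORE expensive, not
less; the card's worry c(χ) → 0 as χ → 1 is settled in the negative for the collar functional), ĝ
stays positive definite (min eigenvalue 0.23 at χ = 1) and
the slab spacelike (N² ≥ 0.34). Cheapest remaining check for refuters: a C²-settled family whose
collar integral fails to converge as
τ → ∞ (only possible if Ψᵢ*g degenerates at r → r₊⁺), or a printed statement of the counting census
(none found, see Novelty).

NUMBERS. Kerr collar calibration (kit j001624, M = 1, collar r₊ < r ≤ 4M on t* = 0, coordinate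
measure): c(0) = 7π/8 = 2.7489 (exact; numerics 2.748895),
c(0.3) = 3.0456, c(0.6) = 4.3239, c(0.8) = 6.9862, c(0.9) = 10.6577, c(0.95) = 14.9850, c(0.99) =
25.0408, c(1) = 40.0740; hence the census constant:
every settled hole of mass Mᵢ charges the collar superenergy ≥ J(Λᵢ)·7π/(8Mᵢ) ≥ 2.7489/Mᵢ, and N ≤
C·max Mᵢ/2.7489 ≤ C·M_ADM/2.7489 for a collar bound C.
Schwarzschild BL slice for comparison: 𝓔(r > 2M) = 16π/(5M); R_MOTS·𝓔 = 32π/5 (card). Dimension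
count: ∫_Σ |Rm|² has length dimension D − 5:
inverted (∝ 1/size) in D = 4, scale-free in D = 5 (where black rings / Gregory–Laflamme defeat
uniqueness) — the census knows the dimension.
Lorentz 3-Jacobian on a spacelike coordinate slab: Gram = I + 2a⃗a⃗ᵀ for an η-orthonormal spacelike
triple (aᵢ, u⃗ᵢ), det = 1 + 2|a⃗|² ≥ 1.
KRS continuation scale λ = ε²/‖R‖²_L² (KlainermanRodnianskiSzeftel2015 §2.3) = the census scale.
Items (after the 2026-08-16 repair): 4 typed (GenericCountableKerrSettling crux r2;
InvertedQuantumCensus support r3; KerrCollarSuperenergyFloor support; Assembly) + 1 informal crux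
(EpsilonRegularityNoStrongTrapping, stmt-FinalStateConjecture-10102) + 3 definition requests
(defn-belRobinsonEnergy, defn-volumeRadius, defn-normSqCovDerivK); `closes :
GenericCountableKerrSettling → InvertedQuantumCensus → FinalStateConjecture`.

DEFINITION REQUESTS. (1) `Hypersurface.belRobinsonEnergy` — for a spacelike hypersurface Σ with
future unit normal n in a 4-dim spacetime, ∫_Σ Q(n,n,n,n) dμ_h with Q the
Bel–Robinson tensor of the Weyl(=Riemann in vacuum) curvature (Senovilla2000 §§2–4;
ChristodoulouKlainerman1993 Ch. 7); equivalently (1/8)∫|Rm|²_(g+2n♭⊗n♭).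
Topic Literature/Geometry/Lorentzian. Needed to state G₁ and the chart-free census. (2)
`InitialDataSet.volumeRadius D r` = inf_(x, r'≤r) vol_h(B_r'(x))/r'³
and geodesic balls of h (KlainermanRodnianskiSzeftel2015 Thm 2.2). (3) a rank-3 metric square norm
(|∇k|²_h via PseudoRiemannianMetric.covDeriv₂), so that
T1's hypothesis ‖∇k‖_L²(B_r) is expressible. Filed with `ledger workitem add --kind definition`
after open, `--for` the T1 item.

DEGENERATE CASES CHECKED. Cone census (route-repair, 2026-08-15): the dependency cone (156 project
constants) contains no unproved CLOSED fact. The two constants flagged at open —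
`PseudoRiemannianMetric.HasLeviCivita` (explicit binder g; the prelude's standing instance
hypothesis, bound as `∀ [g.HasLeviCivita]` inside admissibleVacuumData,
VacuumCauchyDevelopment.isRicciFlat and HasCompleteNullInfinity, i.e. inside the summit Statement
itself) and `CovariantDerivative.CurvatureTensorialAt` (explicit binders cov, x; the definitional
guard of CovariantDerivative.curvature, false for irregular connections and never asserted) — are
Prop-valued PREDICATES: no item asserts them and no proof of InvertedQuantumCensus,
KerrCollarSuperenergyFloor or FiniteFamilyAssembly consumes them (coordinate calculus
MetricCoord.rm4 / tnormSq and re-indexing only); they enter every route of this summit through the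
Statement's own vocabulary (sibling routes LapseTrumpetKID, CurvatureOrSymmetry use them verbatim
and are staffable), so nothing is re-routed and no import is dropped (CoordTensorRicciIdentity is
the module defining MetricCoord.rm4). needs-fact: none for the filed items. Latent and summit-wide,
to be named when G is split and not before: any child of GenericCountableKerrSettling that consumes
Ric(g) = 0 toward a HasLeviCivita-free conclusion needs the existence half of O'Neill 1983 Thm 3.11,
`PseudoRiemannianMetric.isCovariantDerivativeOn_leviCivitaFun` (through HasLeviCivita.of). RE-TYPE
T2 REPAIR (p126844, 2026-08-16, this seat): GenericCountableKerrSettling re-typed 1:1 with the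
Statement (FiniteFamilyAssembly first re-typed alongside, then dropped as an item and proved inside
`closes`) (IsChristodoulouGeneric → IsTameChristodoulouGeneric; `∃ R` exhaustion witness now the
3-tuple with honest radii; RaysStayInClosure 𝒟 O added to G and carried to the summit unchanged
since d is built over the same O; the ι-form of IsFutureOriented added to G and re-indexed inside
`closes`); InvertedQuantumCensus, KerrCollarSuperenergyFloor and the informal T1 untouched; Assembly
restated to the type of `closes`; `closes : GenericCountableKerrSettling → InvertedQuantumCensus →
FinalStateConjecture` re-elaborated (Sketch2.lean rc 0, 0 sorries, axioms
propext/Classical.choice/Quot.sound) — its one non-crux hypothesis is the support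
InvertedQuantumCensus (stmt-FinalStateConjecture-10095, M-sized, staffable): PROVE it, then `route
edit --closes-file` invoking `InvertedQuantumCensus_holds` makes the deciding theorem crux-only. No
new hypothesis was needed: the new conjuncts are supplied INSIDE the generic crux G, exactly as the
old exhaustive-charts clause was (G = the summit's conclusion with Fin N replaced by an arbitrary ι,
plus Mᵢ ≤ M and the collar bound).

Novelty: Searches (2026-08-15): card's own log (galaxy intelligent/pdf "small L2 norm of curvature on a ball
excludes trapped surfaces / epsilon-regularity lower
bound on the size of black holes" 15 rows, Crossref "trapped surfaces curvature concentration
necessary condition", grep of held KRS text for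
trapped|black hole = 0) + the 2nd-unit novelty audit (zbMATH "Bel-Robinson energy" 40 rows,
"necessary conditions trapped surfaces curvature", Crossref
"absence of trapped surfaces small curvature initial data"; nearest An–Luk arXiv:1409.6270 p.4) +
this seat: `lit search --hybrid "Bel-Robinson energy
lower bound black hole mass number of black holes curvature integral"` (12 book rows: Ashtekar
centennial, Brito superradiance, Wald — no counting use);
`lit frontier FinalStateConjecture --since 2021` (30 rows; nearest ShenWan2026 arXiv:2601.01517:
vacuum N-body Cauchy data forming N causally independent trapped regions for EVERY finite N with
prescribed (E,P,J) — the construction side, no bound on N, consistent with the census charging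
Σ1/Mᵢ), `lit bridges FinalStateConjecture --cross any` (30 rows, surveys only), `lit search --source
zbmath "finitely many black holes"` (14 rows; nearest Andersson–Mars–Metzger–Simon arXiv:0811.4721,
evolution of MOTTs, no counting by curvature), `--source zbmath "superenergy black hole"` (1 row,
arXiv:1501.04641 Maxwell decay), `--source zbmath "Bel-Robinson energy trapped surface" / "L2
curvature trapped surfaces"` (0), galaxy `--star all "finitely many  [refs: 10.1007/BF01216187, 10.1103/PhysRevLett.66.2421, 1409.6270, 2601.01517, 0811.4721, 1501.04641, 1204.1767, doi:10.1007/BF01216187, doi:10.1103/PhysRevLett.66.2421, ShenWan2026, KlainermanRodnianskiSzeftel2015, AnLuk2017, Uhlenbeck1982]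

Barriers (technique_class: L2-curvature, epsilon-regularity, superenergy-census): - technique_class: L2-curvature, epsilon-regularity, superenergy-census
- Literature.Barriers.FinalStateConjecture.GregoryLaflammeInstability: evaded by construction — the
engine is the D = 4 scaling of ∫|Rm|² (length⁻¹); in D = 5 the quantum is scale-free and the census
(correctly) proves nothing, consistent with black rings / GL cascades there.
- Literature.Barriers.FinalStateConjecture.AretakisInstability: consistent — extremal horizons are
excluded by the summit (|aᵢ| < Mᵢ) and the collar floor is taken over the CLOSED range |a| ≤ M
(KerrCollarSuperenergyFloor), so near-extremal remnants are still charged ≥ c/M; no decay statement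
on extremal backgrounds is made.
- Literature.Barriers.FinalStateConjecture.nakedSingularityInstability: not engaged — censorship
sits inside G exactly as in the summit (complete 𝓘⁺ for generic data); the census makes no
censorship claim; threshold (non-generic) data are the card's own calibration of why only an ω-limit
/ generic bound can hold.
- Literature.Barriers.FinalStateConjecture.KehrbergerLogarithmicAsymptoticsCorrected: not engaged —
collars are compact pieces of asymptotically flat Kerr–Schild slabs (|Rm|² ~ r⁻⁶ integrable), no
conformal regularity of 𝓘⁺ and no hyperboloidal slicing is used.
- Literature.Barriers.FinalStateConjecture.PriceLawTail: not engaged — no decay RATE is asserted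
anywhere; C² convergence without rate is the summit's own clause.
- Literature.Barriers.FinalStateConjecture.KerrSuperradiance: not engaged — no linea

History (route lifecycle, newest last):
- 2026-08-15T15:20:28Z · rev 2: dropped stmt-FinalStateConjecture-10106 — drop accidental duplicate informal item stmt-FinalStateConjecture-10106 (identical to stmt-FinalStateConjecture-10102 = EpsilonRegularityNoStrongTrapping, creat (planner-plancard-FinalStateConjecture-FinalSt-d9b556e3-0)
- 2026-08-16T23:19:36Z · rev 7: restated GenericCountableKerrSettling (stmt-FinalStateConjecture-10094), FiniteFamilyAssembly (stmt-FinalStateConjecture-10096) — route-repair (statement-revised, re-type T2 p126844): restate GenericCountableKerrSettling (IsTameChristodoulouGeneric; honest-radii 3-tuple exhaustion; + RaysS (planner-rrepair-FinalStateConjecture-Superener-edae79ae-0)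
- 2026-08-16T23:27:21Z · rev 8: restated Assembly (stmt-FinalStateConjecture-10098) — route-repair (re-type T2, step 2 — crux-only shape): closes := GenericCountableKerrSettling → InvertedQuantumCensus → FinalStateConjecture (re-indexing glue for (planner-rrepair-FinalStateConjecture-Superener-edae79ae-0)
- 2026-08-16T23:27:21Z · rev 8: dropped FiniteFamilyAssembly — route-repair (re-type T2, step 2 — crux-only shape): closes := GenericCountableKerrSettling → InvertedQuantumCensus → FinalStateConjecture (re-indexing glue for (planner-rrepair-FinalStateConjecture-Superener-edae79ae-0)
- 2026-08-24T02:26:56Z · DORMANT — reconciler: no traction for 6.4 d (last activity item-evidence-added at 2026-08-17T14:57:37Z); parked, not closed — `ledger route dormant route-FinalStateConjec (operator:999:1344473)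

sub-problem: FinalStateConjecture · status: dormant · opened planner-plancard-FinalStateConjecture-FinalSt-d9b556e3-0 2026-08-15T15:08:01Z · rev 10 · ledger route-FinalStateConjecture-SuperenergyCensus
GENERATED by the gate from the ledger (D-0016/17). Provers cite these decls: `theorem foo : Summit.FinalStateConjecture.FinalStateConjecture.Theses.SuperenergyCensus.<Decl> := …` in Summits/FinalStateConjecture/FinalStateConjecture/Theorems/<Name>.lean.
-/

namespace Summit.FinalStateConjecture.FinalStateConjecture.Theses.SuperenergyCensus

open scoped BigOperators Topology Manifold Classical MeasureTheory ProbabilityTheory Matrix InnerProductSpace ComplexConjugate ContinuousMap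
open Filter Set Function TopologicalSpace MeasureTheory

attribute [summit_statement] _root_.FinalStateConjecture

-- earlier GenericCountableKerrSettling (stmt-FinalStateConjecture-10094, replaced 2026-08-16T23:19:36Z -> stmt-FinalStateConjecture-17465): retired by None — ∀ (X : Type) [TopologicalSpace X] [ChartedSpace Literature.Geometry.Lorentzian.E3 X] [IsManifold (𝓡 3) ((⊤ : ℕ∞) : WithTop ℕ∞) X] [T2Space X] [SecondCountableTopology X] [ConnectedSpace X], Literature.Geometry.Lorentzian.InitialDataSet.IsChrist
/-- item stmt-FinalStateConjecture-17465 · crux · rank 2 · open · by planner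
why it might fail: Open ⊇ WCC + large-data multi-Kerr stability; modulo the census ≡ FSC ∧ (Mᵢ ≤ M_ADM). False if an open set of admissible data leaves infinitely many ever-smaller holes (threshold collapse is codim 1 per hole, arXiv:2305.17171), if extremal remnants are generic (arXiv:2402.10190), or some Mᵢ > M_ADM.
sources: DafermosLuk2017, Christodoulou1999, KlainermanSzeftel2023, GiorgiKlainermanSzeftel2022, DafermosHolzegelRodnianskiTaylor2021, BondiVanderburgMetzner1962
[crux] For every connected Hausdorff second-countable smooth 3-manifold X,
TAME-Christodoulou-generically in admissibleVacuumData X (InitialDataSet.IsTameChristodoulouGeneric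
… 1, re-type T2: through every exceptional admissible datum an injective one-parameter family of
admissible data, tame on ONE fixed end and immersed at 0): an MGHD exists, and every MGHD 𝒟 has
complete future null infinity (Summit.FinalStateConjecture.HasCompleteNullInfinity) and, for some AF
end e with DR mass parameter M, a region O ⊆ 𝒟, an index type ι, masses/spins with |aᵢ| < Mᵢ
(Kerr.IsSubextremal), motions (Λᵢ, cᵢ), a late time τ₀, hole charts Ψᵢ on the boosted Kerr exteriors
and a flat chart Ψ₀ on flatDomain ⊇ {x⁰ > τ₀} minus sublinear tubes, such that: every Ψᵢ, Ψ₀ is a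
late chart into O; C² deviation from boosted Kerr → 0 on every truncated slab {t*ᵢ = τ, rᵢ ≤ R};
near zones eventually pairwise disjoint for every R; C² deviation from η → 0 on the flat slabs; the
covering clause O ∖ (late images) ⊆ J⁻(initial slabs); the exhaustive-charts clause with HONEST
growing radii Rᵢ(τ) → ∞, Rᵢ(τ) ≥ max(r₊(Mᵢ,aᵢ), 0) + 1, out to which the truncated C² deviation
still → 0 and for every τ₁ > τ₀, O ∖ certified-lat -/
@[route_item "route-FinalStateConjecture-SuperenergyCensus", crux]
def GenericCountableKerrSettling : Prop :=
  ∀ (X : Type) [TopologicalSpace X] [ChartedSpace Literature.Geometry.Lorentzian.E3 X] [IsManifold (𝓡 3) (⊤ : ℕ∞) X] [T2Space X] [SecondCountableTopology X] [ConnectedSpace X], Literature.Geometry.Lorentzian.InitialDataSet.IsTameChristodoulouGeneric (Literature.Geometry.Lorentzian.admissibleVacuumData X) (fun D ↦ (∃ 𝒟 : Literature.Geometry.Lorentzian.VacuumCauchyDevelopment D, 𝒟.IsMaximal) ∧ ∀ 𝒟 : Literature.Geometry.Lorentzian.VacuumCauchyDevelopment D, 𝒟.IsMaximal → HasCompleteNullInfinity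 𝒟.toCauchyDevelopment ∧ ∃ (e : Literature.Geometry.Lorentzian.AFEnd X) (M : ℝ), e.IsStronglyAsymptoticallyFlatDR D M ∧ ∃ (O : Set 𝒟.carrier) (ι : Type) (mass spin : ι → ℝ) (motion : ι → Literature.Geometry.Lorentzian.lorentzGroup × Literature.Geometry.Lorentzian.E4) (τ₀ : ℝ) (Ψ : ∀ i, Literature.Geometry.Lorentzian.boostedKerrExterior (motion i).1 (motion i).2 (mass i) (spin i) → 𝒟.carrier) (ρ : ι → ℝ → ℝ) (U₀ : TopologicalSpace.Opens Literature.Geometry.Lorentzian.E4) (Ψ₀ : U₀ → 𝒟.carrier), let B := fun i ↦ Literature.Geometry.Lorentzian.boostedKerrBackground (motion i).1 (motion i).2 (mass i) (spin i); let G := fun i w ↦ 𝒟.deviationExtend (B i) (Ψ i) w + (B i).bilin w; let M₀ := Literature.Geometry.Lorentzian.Minkowski.backgroundOn U₀; ((∀ i, Literature.Geometry.Lorentzian.Kerr.IsSubextremal (mass i) (spin i)) ∧ (∀ i, 𝒟.IsLateChart (B i) O τ₀ (Ψ i)) ∧ (∀ i R, Tendsto (fun τ ↦ 𝒟.truncDeviationCk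 (B i) (Ψ i) 2 R τ) atTop (nhds 0))) ∧ ((∀ R, ∃ τ₁, Pairwise (Function.onFun Disjoint fun i ↦ Ψ i '' (B i).truncLateRegion τ₁ R)) ∧ (∀ i, Tendsto (fun t ↦ ρ i t / t) atTop (nhds 0)) ∧ ({x : Literature.Geometry.Lorentzian.E4 | τ₀ < x 0 ∧ ∀ i, ρ i (x 0) < Literature.Geometry.Lorentzian.Kerr.radius (spin i) (Literature.Geometry.Lorentzian.poincareInv (motion i).1 (motion i).2 x)} ⊆ (U₀ : Set Literature.Geometry.Lorentzian.E4)) ∧ 𝒟.IsLateChart M₀ O τ₀ Ψ₀ ∧ Tendsto (fun τ ↦ 𝒟.deviationCk M₀ Ψ₀ 2 τ) atTop (nhds 0) ∧ (O \ ((⋃ i, Ψ i '' (B i).lateRegion τ₀) ∪ Ψ₀ '' M₀.lateRegion τ₀) ⊆ 𝒟.metric.causalPast 𝒟.timeOrientation ((⋃ i, Ψ i '' (B i).timeSlab τ₀) ∪ Ψ₀ '' M₀.timeSlab τ₀)) ∧ (∃ R : ι → ℝ → ℝ, (∀ i, Tendsto (R i) atTop atTop ∧ ∀ τ, max (Literature.Geometry.Lorentzian.Kerr.rPlus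 (mass i) (spin i)) 0 + 1 ≤ R i τ) ∧ (∀ i, Tendsto (fun τ ↦ 𝒟.truncDeviationCk (B i) (Ψ i) 2 (R i τ) τ) atTop (nhds 0)) ∧ ∀ τ₁, τ₀ < τ₁ → O \ (Ψ₀ '' M₀.lateRegion τ₁ ∪ ⋃ i, Ψ i '' {x | τ₁ < (B i).time x.1 ∧ (B i).radius x.1 ≤ R i ((B i).time x.1)}) ⊆ 𝒟.metric.causalPast 𝒟.timeOrientation (Ψ₀ '' M₀.timeSlab τ₁ ∪ ⋃ i, Ψ i '' (B i).truncTimeSlab (R i τ₁) τ₁))) ∧ O = exteriorOf 𝒟.toCauchyDevelopment (Ψ₀ '' M₀.lateRegion τ₀ ∪ ⋃ i, Ψ i '' (B i).lateRegion τ₀) ∧ RaysStayInClosure 𝒟.toCauchyDevelopment O ∧ ((∀ i, IsOrthochronous (motion i).1) ∧ (∀ i r, ∀ᶠ τ in atTop, ∀ x ∈ (B i).truncTimeSlab r τ, 𝒟.timeOrientation.IsFutureDirected (mfderiv 𝓘(ℝ, Literature.Geometry.Lorentzian.E4) (𝓡 4) (Ψ i) x (((motion i).1 : Literature.Geometry.Lorentzian.E4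 ≃L[ℝ] Literature.Geometry.Lorentzian.E4) (Literature.Geometry.Lorentzian.Kerr.timeVector (mass i) (spin i) (Literature.Geometry.Lorentzian.poincareInv (motion i).1 (motion i).2 x.1))))) ∧ ∀ᶠ τ in atTop, ∀ x ∈ M₀.timeSlab τ, 𝒟.timeOrientation.IsFutureDirected (mfderiv 𝓘(ℝ, Literature.Geometry.Lorentzian.E4) (𝓡 4) Ψ₀ x (Literature.Geometry.Lorentzian.E4.basisVector 0))) ∧ (∀ i, mass i ≤ M) ∧ ∃ C < (⊤ : ENNReal), ∀ s : Finset ι, ∃ᶠ τ in atTop, (∑ i ∈ s, ∫⁻ y in {y | y ∈ (B i).domain ∧ (B i).time y = τ ∧ (B i).radius y ≤ 4 * mass i}, ENNReal.ofReal ((1 / 8 : ℝ) * Literature.Geometry.Lorentzian.MetricCoord.tnormSq (fun z ↦ G i z + (2 * (-((fderiv ℝ (B i).time z) (Literature.Geometry.Lorentzian.MetricCoord.sharpAt (G i) z (fderiv ℝ (B i).time z))))⁻¹) • Literature.Geometry.Lorentzian.E4.tmul (fderiv ℝ (B i).time z) (fderiv ℝ (B i).time z)) (EuclideanSpace.basisFun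 (Fin 4) ℝ).toBasis (Literature.Geometry.Lorentzian.MetricCoord.rm4 (G i) (EuclideanSpace.basisFun (Fin 4) ℝ).toBasis) y) ∂μH[3]) ≤ C) 1

/-- item stmt-FinalStateConjecture-10095 · crux · rank 3 · open · by planner
why it might fail: Rests on the UNPROVED floor inf_{|a|≤M} M·E_KS(M,a) > 0 (KerrCollarSuperenergyFloor: numerics at 8 spins, extremal end included) and on uniform C² control of ĝ = Ψ*g+2N²dt*² and tnormSq∘rm4 down to r→r₊⁺ on the open collar; inf = 0, a zero-density direction or lost uniformity breaks the count.
sources: KlainermanRodnianskiSzeftel2015, Senovilla2000, ChristodoulouKlainerman1993, KerrSchild1965, Uhlenbeck1982, arXiv:1204.1767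
[crux] THE CENSUS. For every Spacetime 𝓢 (dim 4), region O, index type ι, sub-extremal parameters
(Mᵢ, aᵢ), motions, τ₀ and hole charts Ψᵢ that are late charts into O whose C² deviation from boosted
Kerr (Mᵢ, aᵢ, Λᵢ, cᵢ) tends to 0 on every truncated slab: if the masses are bounded (Mᵢ ≤ K) and the
collar superenergies satisfy ∃ C < ∞, ∀ finite s ⊆ ι, frequently in τ, Σ_{i∈s} 𝓔ᵢ(τ) ≤ C (same 𝓔ᵢ,
`B i`, `G i` as in GenericCountableKerrSettling), then ι is finite. Intended proof: C² convergence
on the collar {r₊ < r ≤ 4Mᵢ} makes 𝓔ᵢ(τ) → J(Λᵢ)·𝓔_Kerr(Mᵢ, aᵢ) with Euclidean 3-Jacobian J(Λ) = √(1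
+ 2|a⃗|²) ≥ 1 of the Lorentz map on the slab and 𝓔_Kerr(M, a) ≥ c/M (KerrCollarSuperenergyFloor,
scaling x ↦ Mx); hence |s|·c/K ≤ Σ_{i∈s} c/Mᵢ ≤ C for every finite s. Duplicated charts are charged
per index, so no disjointness is needed. Card: CENSUS corollary (N ≤ (𝓔/ε₀c)·max Rᵢ) in the settled
regime. [deps: KerrCollarSuperenergyFloor] [difficulty: M] -/
@[route_item "route-FinalStateConjecture-SuperenergyCensus", crux]
def InvertedQuantumCensus : Prop :=
  ∀ (𝓢 : Literature.Geometry.Lorentzian.Spacetime.{0} 4) (O : Set 𝓢.carrier) (ι : Type) (mass spin : ι → ℝ) (motion : ι → Literature.Geometry.Lorentzian.lorentzGroup × Literature.Geometry.Lorentzian.E4) (τ₀ : ℝ) (chart : ∀ i, Literature.Geometry.Lorentzian.boostedKerrExterior (motion i).1 (motion i).2 (mass i) (spin i) → 𝓢.carrier), let B : ι → Literature.Geometry.Lorentzian.ModelBackground := fun i ↦ Literature.Geometry.Lorentzian.boostedKerrBackground (motion i).1 (motion i).2 (mass i) (spin i); let G : ι → Literature.Geometry.Lorentzian.E4 → (Literature.Geometry.Lorentzian.E4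 →L[ℝ] Literature.Geometry.Lorentzian.E4 →L[ℝ] ℝ) := fun i w ↦ 𝓢.deviationExtend (B i) (chart i) w + (B i).bilin w; ((∀ i, Literature.Geometry.Lorentzian.Kerr.IsSubextremal (mass i) (spin i)) ∧ (∀ i, 𝓢.IsLateChart (B i) O τ₀ (chart i)) ∧ (∀ i (R : ℝ), Filter.Tendsto (fun τ ↦ 𝓢.truncDeviationCk (B i) (chart i) 2 R τ) Filter.atTop (nhds 0))) → (∃ K : ℝ, ∀ i, mass i ≤ K) → (∃ C : ENNReal, C < ⊤ ∧ ∀ s : Finset ι, Filter.Frequently (fun τ ↦ (Finset.sum s fun i ↦ MeasureTheory.lintegral ((MeasureTheory.Measure.hausdorffMeasure 3).restrict {y : Literature.Geometry.Lorentzian.E4 | y ∈ (B i).domain ∧ (B i).time y = τ ∧ (B i).radius y ≤ 4 * mass i}) (fun y ↦ ENNReal.ofReal ((1 / 8 : ℝ) * Literature.Geometry.Lorentzian.MetricCoord.tnormSq (fun z ↦ (G i) z + (2 * (-((fderiv ℝ (B i).time z) (Literature.Geometry.Lorentzian.MetricCoord.sharpAt (G i) z (fderiv ℝ (B i).time z))))⁻¹)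 • Literature.Geometry.Lorentzian.E4.tmul (fderiv ℝ (B i).time z) (fderiv ℝ (B i).time z)) (EuclideanSpace.basisFun (Fin 4) ℝ).toBasis (Literature.Geometry.Lorentzian.MetricCoord.rm4 (G i) (EuclideanSpace.basisFun (Fin 4) ℝ).toBasis) y))) ≤ C) Filter.atTop) → Finite ι

-- item stmt-FinalStateConjecture-10102 · crux · rank 4 · open · by planner — informal only, no Lean statement yet:
--   [crux] EpsilonRegularityNoStrongTrapping — card K1 = T1 "ε-regularity forbids strong trapping", the
--   layer-2 tool for splitting GenericCountableKerrSettling into (census slices with bounded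
--   superenergy) → (finitely many floored horizon components) → (per-component Kerr asymptotics). CLAIM:
--   there are ε₀(v₀) > 0 and C₀ < ∞ such that if (Σ, h, k) is a maximal (tr_h k = 0) vacuum initial data
--   set (slice of a vacuum development), B_r(p) ⊂ Σ an h-geodesic ball with volume radius ≥ v₀ at scales
--   ≤ r, and r·(‖Ric(h)‖²_{L²(B_r)} + ‖∇k‖²_{L²(B_r)}) ≤ ε₀ (equivalently: small scale-invariant
--   Bel–Robinson su

/-- item stmt-FinalStateConjecture-10097 · support · rank 9 · open · by planner
sources: KerrSchild1965, Senovilla2000, ChristodoulouKlainerman1993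
[support] Calibration P1 of the card (provable now, explicit): there is c > 0 such that for all 0 <
M and |a| ≤ M the coordinate Bel–Robinson superenergy of the Kerr–Schild slice {t* = 0, r₊ < r ≤ 4M}
of Kerr (M, a) — (1/8)∫ |Rm_g|²_ĝ dμ_H³ with g = Kerr.bilin M a, ĝ = g + 2N² dt*⊗dt* — is at least
c/M. Proof: scaling x ↦ Mx gives 𝓔(M, a) = 𝓔(1, a/M)/M; χ ↦ 𝓔(1, χ) is continuous on [−1, 1] (r₊ = 1
+ √(1−χ²) continuous, integrand smooth and bounded on r ≥ 1) and positive (Kerr is nowhere flat on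
the collar; the collar r₊ ≤ 2 < 4 has positive measure); Schwarzschild t = const value for
comparison: 16π/(5M). [difficulty: M] -/
@[route_item "route-FinalStateConjecture-SuperenergyCensus"]
def KerrCollarSuperenergyFloor : Prop :=
  ∃ c : ℝ, 0 < c ∧ ∀ M a : ℝ, 0 < M → |a| ≤ M → ENNReal.ofReal (c / M) ≤ MeasureTheory.lintegral ((MeasureTheory.Measure.hausdorffMeasure 3).restrict {y : Literature.Geometry.Lorentzian.E4 | Literature.Geometry.Lorentzian.Kerr.rPlus M a < Literature.Geometry.Lorentzian.Kerr.radius a y ∧ y 0 = 0 ∧ Literature.Geometry.Lorentzian.Kerr.radius a y ≤ 4 * M}) (fun y ↦ ENNReal.ofReal ((1 / 8 : ℝ) * Literature.Geometry.Lorentzian.MetricCoord.tnormSq (fun z ↦ (Literature.Geometry.Lorentzian.Kerr.bilin M a) z + (2 * (-((fderiv ℝ (fun w : Literature.Geometry.Lorentzian.E4 ↦ w 0) z) (Literature.Geometry.Lorentzian.MetricCoord.sharpAt (Literature.Geometry.Lorentzian.Kerr.bilin M a) z (fderiv ℝ (fun w : Literature.Geometry.Lorentzian.E4 ↦ w 0)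 z))))⁻¹) • Literature.Geometry.Lorentzian.E4.tmul (fderiv ℝ (fun w : Literature.Geometry.Lorentzian.E4 ↦ w 0) z) (fderiv ℝ (fun w : Literature.Geometry.Lorentzian.E4 ↦ w 0) z)) (EuclideanSpace.basisFun (Fin 4) ℝ).toBasis (Literature.Geometry.Lorentzian.MetricCoord.rm4 (Literature.Geometry.Lorentzian.Kerr.bilin M a) (EuclideanSpace.basisFun (Fin 4) ℝ).toBasis) y))

-- earlier Assembly (stmt-FinalStateConjecture-10098, replaced 2026-08-16T23:27:21Z -> stmt-FinalStateConjecture-17691): retired by None — GenericCountableKerrSettling → InvertedQuantumCensus → FiniteFamilyAssembly → KerrCollarSuperenergyFloor → FinalStateConjecture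
/-- item stmt-FinalStateConjecture-17691 · assembly · rank 1 · open · by planner
sources: DafermosLuk2017, Christodoulou1999
[assembly] GenericCountableKerrSettling → InvertedQuantumCensus → FinalStateConjecture (root-level
summit decl) — literally the type of `closes` (the re-indexing glue formerly FiniteFamilyAssembly is
proved inside `closes`; the calibration KerrCollarSuperenergyFloor is consumed by the census' proof,
not assumed). -/
@[route_item "route-FinalStateConjecture-SuperenergyCensus"]
def Assembly : Prop :=
  GenericCountableKerrSettling → InvertedQuantumCensus → FinalStateConjecture

-- records of items no longer active in this route (dropped / restated):
-- earlier FiniteFamilyAssembly (stmt-FinalStateConjecture-10096, replaced 2026-08-16T23:19:36Z -> stmt-FinalStateConjecture-17466): retired by None — ∀ (X : Type) [TopologicalSpace X] [ChartedSpace Literature.Geometry.Lorentzian.E3 X] [IsManifold (𝓡 3) ((⊤ : ℕ∞) : WithTop ℕ∞) X] [T2Space X] [SecondCountableTopology X] [ConnectedSpace X] (D : Literature.Geometry.Lorentzian.InitialDataSet (𝓡 3) X) (𝒟 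

/-! D-0027 §2.1 — DECIDING THEOREM (planner-authored via `route open/edit --closes-file`; by planner-rbadge-FinalStateConjecture-Superenerg-3c632627-0 2026-08-16T23:40:08Z):
its hypotheses are this route's items and its conclusion the sub-problem Statement (glue_lint), and it elaborates with this file. -/

@[closes "route-FinalStateConjecture-SuperenergyCensus"] theorem closes : GenericCountableKerrSettling → InvertedQuantumCensus → FinalStateConjecture := by
  intro hG hC X _ _ _ _ _ _
  -- Tame Christodoulou genericity (re-type T2) is monotone in the property: the SAME tame,
  -- immersed, injective one-parameter family of admissible data through an exceptional datum works.
  have mono : ∀ (Φ P : Literature.Geometry.Lorentzian.InitialDataSet (𝓡 3) X → Prop),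
      (∀ D ∈ Literature.Geometry.Lorentzian.admissibleVacuumData X, Φ D → P D) →
      Literature.Geometry.Lorentzian.InitialDataSet.IsTameChristodoulouGeneric (Literature.Geometry.Lorentzian.admissibleVacuumData X) Φ 1 →
      Literature.Geometry.Lorentzian.InitialDataSet.IsTameChristodoulouGeneric (Literature.Geometry.Lorentzian.admissibleVacuumData X) P 1 := by
    intro Φ P hΦP hgen D hD
    obtain ⟨hDadm, hnot⟩ := hD
    obtain ⟨e, F, hT, hImm, h0, hinj, hFD, hFE⟩ := hgen D ⟨hDadm, fun h ↦ hnot (hΦP D hDadm h)⟩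
    exact ⟨e, F, hT, hImm, h0, hinj, hFD, fun c hc hmem ↦ hFE c hc ⟨hmem.1, fun h ↦ hmem.2 (hΦP _ hmem.1 h)⟩⟩
  refine mono _ _ ?_ (hG X)
  intro D _hD h
  refine ⟨h.1, fun 𝒟 hmax ↦ ?_⟩
  -- the census package of G for this MGHD: complete 𝓘⁺, the DR end/mass, the ι-indexed settled family with the
  -- summit's clauses verbatim (near zones; separation/flat zone/covering/honest-radii exhaustion; O = exteriorOf;
  -- rays stay in closure O; future orientation), the mass bound and the collar superenergy bound
  obtain ⟨hscri, e, M, hAF, O, ι, mass, spin, motion, τ₀, Ψ, ρ, U₀, Ψ₀,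
    hnear, hfar, hO, hrays, horient, hmass, hSE⟩ := h.2 𝒟 hmax
  refine ⟨hscri, ?_⟩
  -- THE CENSUS: bounded masses + bounded collar superenergy ⟹ finitely many holes
  have hfin : Finite ι := hC 𝒟.toSpacetime O ι mass spin motion τ₀ Ψ hnear ⟨M, hmass⟩ hSE
  -- RE-INDEXING GLUE (formerly the support item FiniteFamilyAssembly, proved here): ι ≃ Fin N, every field
  -- precomposed with the equivalence; ι- and Fin N-indexed unions agree.
  obtain ⟨N, ⟨eqv⟩⟩ := Finite.exists_equiv_fin ι
  obtain ⟨hsub, hlate, hconv⟩ := hnear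
  obtain ⟨hdisj, hexc, hU₀, hlate₀, hconv₀, hcov, R, hR, hRconv, hexh⟩ := hfar
  obtain ⟨hortho, hholes, hflat⟩ := horient
  have key : ∀ F : ι → Set 𝒟.carrier, (⋃ j, F (eqv.symm j)) = ⋃ i, F i :=
    fun F ↦ eqv.symm.surjective.iUnion_comp F
  rw [← key (fun i ↦ Ψ i '' (Literature.Geometry.Lorentzian.boostedKerrBackground (motion i).1 (motion i).2 (mass i) (spin i)).lateRegion τ₀)] at hO
  rw [← key (fun i ↦ Ψ i '' (Literature.Geometry.Lorentzian.boostedKerrBackground (motion i).1 (motion i).2 (mass i) (spin i)).lateRegion τ₀), ← key (fun i ↦ Ψ i '' (Literature.Geometry.Lorentzian.boostedKerrBackground (motion i).1 (motion i).2 (mass i) (spin i)).timeSlab τ₀)] at hcov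
  refine ⟨O,
    { N := N
      mass := fun j ↦ mass (eqv.symm j)
      spin := fun j ↦ spin (eqv.symm j)
      mass_pos := fun j ↦ lt_of_le_of_lt (abs_nonneg (spin (eqv.symm j)))
        (hsub (eqv.symm j) : |spin (eqv.symm j)| < mass (eqv.symm j))
      abs_spin_le_mass := fun j ↦ le_of_lt (hsub (eqv.symm j) : |spin (eqv.symm j)| < mass (eqv.symm j))
      motion := fun j ↦ motion (eqv.symm j)
      τ₀ := τ₀
      chart := fun j ↦ Ψ (eqv.symm j)
      isLateChart := fun j ↦ hlate (eqv.symm j)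
      tendsto_truncDeviationCk := fun j R' ↦ hconv (eqv.symm j) R'
      exists_pairwise_disjoint := fun R' ↦ (hdisj R').imp fun τ₁ hτ₁ ↦
        hτ₁.comp_of_injective eqv.symm.injective
      excision := fun j ↦ ρ (eqv.symm j)
      tendsto_excision_div := fun j ↦ hexc (eqv.symm j)
      flatDomain := U₀
      setOf_lt_excision_subset_flatDomain := fun x hx ↦ hU₀ ⟨hx.1, fun i ↦ by simpa using hx.2 (eqv i)⟩
      flatChart := Ψ₀
      isLateChart_flat := hlate₀
      tendsto_deviationCk_flat := hconv₀
      diff_subset_causalPast := hcov },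
    fun j ↦ hsub (eqv.symm j), hO, hrays, ?_, ?_⟩
  · -- HasExhaustiveCharts with the honest radii Rⱼ := R (eqv.symm j)
    refine ⟨fun j ↦ R (eqv.symm j), fun j ↦ hR (eqv.symm j), fun j ↦ hRconv (eqv.symm j), fun τ₁ hτ₁ ↦ ?_⟩
    have h₁ := hexh τ₁ hτ₁
    rw [← key (fun i ↦ Ψ i '' {x | τ₁ < (Literature.Geometry.Lorentzian.boostedKerrBackground (motion i).1 (motion i).2 (mass i) (spin i)).time x.1 ∧ (Literature.Geometry.Lorentzian.boostedKerrBackground (motion i).1 (motion i).2 (mass i) (spin i)).radius x.1 ≤ R i ((Literature.Geometry.Lorentzian.boostedKerrBackground (motion i).1 (motion i).2 (mass i) (spin i)).time x.1)}),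
      ← key (fun i ↦ Ψ i '' (Literature.Geometry.Lorentzian.boostedKerrBackground (motion i).1 (motion i).2 (mass i) (spin i)).truncTimeSlab (R i τ₁) τ₁)] at h₁
    exact h₁
  · -- IsFutureOriented: orthochronous motions; eventually future-directed push-forwards (ι-form re-indexed)
    exact ⟨fun j ↦ hortho (eqv.symm j), fun j r ↦ hholes (eqv.symm j) r, hflat⟩

end Summit.FinalStateConjecture.FinalStateConjecture.Theses.SuperenergyCensus
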